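import Summits.Ventures.Crystal3D.Theorems.StickyWulffConstantCoaxialWallLawSeamSealedRowZTermWitness
import HarnessLib

/-!
# `UnionCoreSealedCapWin₃ (2·√6)` IS FALSE: the UNFLOORED PAYER TERM (lane F v8.3 `stub_unionCoreSealedCapWin3`, withdrawn in v8.3R)
# (crux `CoaxialWallLaw`, stmt-Ventures-19481; line `WallLedgerF`, skeleton 'CoaxialWallLawCertificates'; cf-p1 (cclxxxiii)(2): «the Negative of record»)

HONEST FRAMING. Venture `Summits/Ventures/Crystal3D` (cell `crystal3d-full`); a REFUTATION of the certificate-shaped INPUT `TailResidue.UnionCoreSealedCapWin₃ s` at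
`s = 2√6` ('…SeamSealedRow', p738494), registered 19:08Z 2026-08-29 as `Cruxes.CoaxialWallLaw.Certificates.stub_unionCoreSealedCapWin3` (lane F v8.3) and withdrawn
19:56Z (v8.3R) after two independent numerical refutations (cf-p2 K-SEAL; this seat's ZTERM, memo HOME/wall-19481-p1/g20/ZTERM-g20.md).  The crux `CoaxialWallLaw`,
`ThreePayer`, `Σ_A` and the T5b statements are NOT touched: the input dies for a bookkeeping reason — `sealedPool₃` floors the pool at `3` only at loaded balls `b ≠ z`,
while the payer `z` (degree `≤ 11`) can ITSELF be the target of several narrow movers, and its own pool `max 1 (sealedGain z) + Σ gains` is `1` once `z` and its core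
contacts are unsealed by single-contact junk (certified gains `0`).  The TRUE functional there is tiny (`Σ_A = 0.078`).  Repair of record (cf-p1 (cclxxxiii)(3)): floor the
payer too, under «ThreePayer at the payer».
THE PROOF on the witness `Yset` of '…SeamSealedRowZTermWitness' (21 balls, payer `0` with `8` contacts):
* §1 the five movers `2, 3, 7, 9, 10` are (A)-end pairs `(0, q)` of `Yset` for the first window system, and their reader pieces lie in the union core (`mover2` … `mover10`);
* §2 **`unionCoreStar Yset 0 v2 SB SH = K`** (the 13 non-junk balls): `⊇` by the reader pieces (`tab_cover`: every `K`-ball is a reader or a reader-placement slot site);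
  `⊆` because the generators lie in `K` (`generators_subset_Kset`: a piece with a junk SITE has at most one `K`-site by the module Gram obstruction, hence no unit triangle,
  hence equals its site set and carries no (A)-pair) and `K` is cap- and star-closed in the window;
* §3 `five_le_endMultA` (the pairs descend to the star-closed union core, '…SeamStarClosure'); every `K`-contact of the payer is UNSEALED with certified gain `0`
  (`≤ 4` core contacts, or `5` with the antipodal pair `{0, 2q}` — no closed vertex star, no `capTable₂` row), the payer's own gain is `≤ 1` (`7` core contacts), so
  `sealedPool Yset K 0 0 ≤ 1`;
* §4 **`not_unionCoreSealedCapWin₃ : ¬ UnionCoreSealedCapWin₃ (2 * Real.sqrt 6)`** (the `b = 0` term alone is `≥ 5 > 2√6`) and `not_stub_unionCoreSealedCapWin3` (verbatim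
  the registered type).
WHAT THIS IS NOT: not a statement about `CoaxialWallLaw`, `ThreePayer` or the T5b stubs; F-C1 not moved.
-/

noncomputable section

namespace Summit.Ventures.Crystal3D.Theorems

namespace ZTerm

open Summit.Ventures.Crystal3D Finset NearIdentity TailResidue
open scoped InnerProductSpace

/-! ### The five movers -/

open scoped Classical in
/-- **Depth-0 mover** (identity frame, basal root `slotSite k`, reading normal `cubeNormal c`) at the table row `iq`, from table facts. -/
theorem mover_refl (iq : Fin 21) {k : Fin 12} (hk : (slotKIJ k).1 = 0) (c : Fin 8)
    (ha : Yc iq + slotQ k = 0) (hb : ∃ i : Fin 21, Yc i = Yc iq - slotQ k) (hc : qdot (slotQ k) (cubeQ c) = 2)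
    (hd : ∀ k' : Fin 12, 0 < qdot (slotQ k') (cubeQ c) → ∃ i : Fin 21, Yc i = Yc iq + slotQ k') (he : ∀ i : Fin 21, Yc i ≠ slotQ k) :
    IsEndPairA Yset WordVersion.v2 SB SH 0 (cubicVecQ (Yc iq)) ∧
      pieceOf Yset 0 (cubicVecQ (Yc iq)) (LinearIsometryEquiv.refl ℝ (EuclideanSpace ℝ (Fin 3))) ⊆ unionCore Yset 0 WordVersion.v2 SB SH := by
  have hq : cubicVecQ (Yc iq) ∈ Yset := mem_Yset iq
  have hqd : cubicVecQ (Yc iq) + slotSite k = 0 := by rw [slotSite_eq_cubicVecQ, ← cubicVecQ_add, ha, cubicVecQ_zero]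
  have hpred : cubicVecQ (Yc iq) - slotSite k ∈ Yset := by
    obtain ⟨i, hi⟩ := hb
    rw [slotSite_eq_cubicVecQ, ← cubicVecQ_sub, ← hi]; exact mem_Yset i
  have hm : IsMenuNormal (LinearIsometryEquiv.refl ℝ (EuclideanSpace ℝ (Fin 3))) (cubeNormal c) := isMenuNormal_cubeNormal c
  have hdm : ⟪slotSite k, cubeNormal c⟫_ℝ = Real.sqrt (2 / 3) := by rw [slotSite_eq_cubicVecQ, inner_cubicVecQ_cubeNormal_eq_sqrt_iff]; exact hc
  have htri : ∀ w ∈ fccSlots, 0 < ⟪(LinearIsometryEquiv.refl ℝ (EuclideanSpace ℝ (Fin 3))) w, cubeNormal c⟫_ℝ →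
      cubicVecQ (Yc iq) + (LinearIsometryEquiv.refl ℝ (EuclideanSpace ℝ (Fin 3))) w ∈ Yset := by
    intro w hw hpos
    obtain ⟨k', rfl⟩ := mem_fccSlots_iff_slotQ.1 hw
    simp only [LinearIsometryEquiv.coe_refl, id_eq] at hpos ⊢
    obtain ⟨i, hi⟩ := hd k' ((inner_cubicVecQ_cubeNormal_pos_iff _ _).1 hpos)
    rw [← cubicVecQ_add, ← hi]; exact mem_Yset i
  have hslot : ∃ w ∈ fccSlots, slotSite k = (LinearIsometryEquiv.refl ℝ (EuclideanSpace ℝ (Fin 3))) w := ⟨slotSite k, slotSite_mem k, rfl⟩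
  have hdX : slotSite k ∉ Yset := by
    rw [slotSite_eq_cubicVecQ, cubicVecQ_mem_Yset_iff]; rintro ⟨i, hi⟩; exact he i hi
  exact ⟨(isEndPairA_zero_of_data SH _ (adm_refl hk) hq zero_mem_Yset hqd hpred hm hdm htri hslot hdX card_contacts_zero.le).1,
    pieceOf_subset_unionCore_of_data Yset_separated SH_RT _ (adm_refl hk) hq zero_mem_Yset hqd hpred hm hdm htri hslot hdX card_contacts_zero.le⟩

open scoped Classical in
/-- **Depth-1 mover** (frame `Fw [cubeNormal c₁]`, basal root `slotSite k` crossing that plane, direction `−Fw[…] r`, reading normal `Fw[…] (cubeNormal c)`). -/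
theorem mover_frame1 (iq : Fin 21) {k : Fin 12} (hk : (slotKIJ k).1 = 0) (c₁ c : Fin 8) (hcross : qdot (slotQ k) (cubeQ c₁) = 2)
    (ha : Yc iq + reflQ c₁ (-slotQ k) = 0) (hb : ∃ i : Fin 21, Yc i = Yc iq - reflQ c₁ (-slotQ k)) (hc : qdot (-slotQ k) (cubeQ c) = 2)
    (hd : ∀ k' : Fin 12, 0 < qdot (slotQ k') (cubeQ c) → ∃ i : Fin 21, Yc i = Yc iq + reflQ c₁ (slotQ k')) (he : ∀ i : Fin 21, Yc i ≠ reflQ c₁ (-slotQ k)) :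
    IsEndPairA Yset WordVersion.v2 SB SH 0 (cubicVecQ (Yc iq)) ∧ pieceOf Yset 0 (cubicVecQ (Yc iq)) (frame1 c₁) ⊆ unionCore Yset 0 WordVersion.v2 SB SH := by
  have hq : cubicVecQ (Yc iq) ∈ Yset := mem_Yset iq
  have hneg : -slotSite k = cubicVecQ (-slotQ k) := by rw [slotSite_eq_cubicVecQ, cubicVecQ_neg]
  have hdd : frame1 c₁ (-slotSite k) = cubicVecQ (reflQ c₁ (-slotQ k)) := by rw [hneg, frame1_cubicVecQ]
  have hqd : cubicVecQ (Yc iq) + frame1 c₁ (-slotSite k) = 0 := by rw [hdd, ← cubicVecQ_add, ha, cubicVecQ_zero]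
  have hpred : cubicVecQ (Yc iq) - frame1 c₁ (-slotSite k) ∈ Yset := by
    obtain ⟨i, hi⟩ := hb
    rw [hdd, ← cubicVecQ_sub, ← hi]; exact mem_Yset i
  have hm : IsMenuNormal (frame1 c₁) (frame1 c₁ (cubeNormal c)) := isMenuNormal_map_self _ (isMenuNormal_cubeNormal c)
  have hdm : ⟪frame1 c₁ (-slotSite k), frame1 c₁ (cubeNormal c)⟫_ℝ = Real.sqrt (2 / 3) := by
    rw [LinearIsometryEquiv.inner_map_map, hneg, inner_cubicVecQ_cubeNormal_eq_sqrt_iff]; exact hc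
  have htri : ∀ w ∈ fccSlots, 0 < ⟪frame1 c₁ w, frame1 c₁ (cubeNormal c)⟫_ℝ → cubicVecQ (Yc iq) + frame1 c₁ w ∈ Yset := by
    intro w hw hpos
    obtain ⟨k', rfl⟩ := mem_fccSlots_iff_slotQ.1 hw
    rw [LinearIsometryEquiv.inner_map_map] at hpos
    obtain ⟨i, hi⟩ := hd k' ((inner_cubicVecQ_cubeNormal_pos_iff _ _).1 hpos)
    rw [frame1_cubicVecQ, ← cubicVecQ_add, ← hi]; exact mem_Yset i
  have hslot : ∃ w ∈ fccSlots, frame1 c₁ (-slotSite k) = frame1 c₁ w := ⟨-slotSite k, neg_mem_fccSlots (slotSite_mem k), rfl⟩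
  have hdX : frame1 c₁ (-slotSite k) ∉ Yset := by
    rw [hdd, cubicVecQ_mem_Yset_iff]; rintro ⟨i, hi⟩; exact he i hi
  exact ⟨(isEndPairA_zero_of_data SH _ (adm_frame1 hk c₁ hcross) hq zero_mem_Yset hqd hpred hm hdm htri hslot hdX card_contacts_zero.le).1,
    pieceOf_subset_unionCore_of_data Yset_separated SH_RT _ (adm_frame1 hk c₁ hcross) hq zero_mem_Yset hqd hpred hm hdm htri hslot hdX card_contacts_zero.le⟩

/-- Mover `2 = (−1,−1,0)`: identity frame, root `slotSite 0 = (1,1,0)`, reading normal `cubeNormal 1 = (1,1,−1)/√3`. -/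
theorem mover2 : IsEndPairA Yset WordVersion.v2 SB SH 0 (cubicVecQ (Yc 2)) ∧
    pieceOf Yset 0 (cubicVecQ (Yc 2)) (LinearIsometryEquiv.refl ℝ (EuclideanSpace ℝ (Fin 3))) ⊆ unionCore Yset 0 WordVersion.v2 SB SH :=
  mover_refl 2 (k := 0) (by decide) 1 (by decide +kernel) (by decide +kernel) (by decide +kernel) (by decide +kernel) (by decide +kernel)

/-- Mover `3 = (−1,0,−1)`: identity frame, root `slotSite 4 = (1,0,1)`, reading normal `cubeNormal 2 = (1,−1,1)/√3`. -/
theorem mover3 : IsEndPairA Yset WordVersion.v2 SB SH 0 (cubicVecQ (Yc 3)) ∧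
    pieceOf Yset 0 (cubicVecQ (Yc 3)) (LinearIsometryEquiv.refl ℝ (EuclideanSpace ℝ (Fin 3))) ⊆ unionCore Yset 0 WordVersion.v2 SB SH :=
  mover_refl 3 (k := 4) (by decide) 2 (by decide +kernel) (by decide +kernel) (by decide +kernel) (by decide +kernel) (by decide +kernel)

/-- Mover `7 = (1,1,−4)/3`: frame `Fw [cubeNormal 6]` (`(−1,−1,1)/√3`), root `slotSite 3 = (−1,−1,0)`, reading normal index `1`. -/
theorem mover7 : IsEndPairA Yset WordVersion.v2 SB SH 0 (cubicVecQ (Yc 7)) ∧ pieceOf Yset 0 (cubicVecQ (Yc 7)) (frame1 6) ⊆ unionCore Yset 0 WordVersion.v2 SB SH :=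
  mover_frame1 7 (k := 3) (by decide) 6 1 (by decide +kernel) (by decide +kernel) (by decide +kernel) (by decide +kernel) (by decide +kernel) (by decide +kernel)

/-- Mover `9 = (1,1,4)/3`: frame `Fw [cubeNormal 7]` (`(−1,−1,−1)/√3`), root `slotSite 3`, reading normal index `1`. -/
theorem mover9 : IsEndPairA Yset WordVersion.v2 SB SH 0 (cubicVecQ (Yc 9)) ∧ pieceOf Yset 0 (cubicVecQ (Yc 9)) (frame1 7) ⊆ unionCore Yset 0 WordVersion.v2 SB SH :=
  mover_frame1 9 (k := 3) (by decide) 7 1 (by decide +kernel) (by decide +kernel) (by decide +kernel) (by decide +kernel) (by decide +kernel) (by decide +kernel)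

/-- Mover `10 = (1,4,1)/3`: frame `Fw [cubeNormal 7]`, root `slotSite 7 = (−1,0,−1)`, reading normal index `2`. -/
theorem mover10 : IsEndPairA Yset WordVersion.v2 SB SH 0 (cubicVecQ (Yc 10)) ∧ pieceOf Yset 0 (cubicVecQ (Yc 10)) (frame1 7) ⊆ unionCore Yset 0 WordVersion.v2 SB SH :=
  mover_frame1 10 (k := 7) (by decide) 7 2 (by decide +kernel) (by decide +kernel) (by decide +kernel) (by decide +kernel) (by decide +kernel) (by decide +kernel)

/-! ### The star-closed union core of the payer is exactly `K` -/

/-- Every `K`-ball is the reader or a reader-placement slot site of one of the five movers (table). -/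
theorem tab_cover : ∀ i : Fin 21, i.val < 13 →
    (i = 2 ∨ ∃ k : Fin 12, Yc i = Yc 2 + slotQ k) ∨ (i = 3 ∨ ∃ k : Fin 12, Yc i = Yc 3 + slotQ k) ∨ (i = 7 ∨ ∃ k : Fin 12, Yc i = Yc 7 + reflQ 6 (slotQ k)) ∨
      (i = 9 ∨ ∃ k : Fin 12, Yc i = Yc 9 + reflQ 7 (slotQ k)) ∨ (i = 10 ∨ ∃ k : Fin 12, Yc i = Yc 10 + reflQ 7 (slotQ k)) := by
  decide +kernel

open scoped Classical in
/-- **`K ⊆ unionCore`**: each `K`-ball lies in the piece of one of the five readers. -/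
theorem Kset_subset_unionCore : Kset ⊆ unionCore Yset 0 WordVersion.v2 SB SH := by
  intro x hx
  obtain ⟨i, hi, rfl⟩ := mem_Kset_iff.1 hx
  have base : ∀ (j : Fin 21) (G : EuclideanSpace ℝ (Fin 3) ≃ₗᵢ[ℝ] EuclideanSpace ℝ (Fin 3)), pieceOf Yset 0 (cubicVecQ (Yc j)) G ⊆ unionCore Yset 0 WordVersion.v2 SB SH →
      cubicVecQ (Yc j) ∈ unionCore Yset 0 WordVersion.v2 SB SH :=
    fun j G h => h (mem_pieceOf_base G (mem_Yset j) (Yset_window _ (mem_Yset j)))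
  have site0 : ∀ (j : Fin 21) (k : Fin 12), Yc i = Yc j + slotQ k →
      pieceOf Yset 0 (cubicVecQ (Yc j)) (LinearIsometryEquiv.refl ℝ (EuclideanSpace ℝ (Fin 3))) ⊆ unionCore Yset 0 WordVersion.v2 SB SH →
      cubicVecQ (Yc i) ∈ unionCore Yset 0 WordVersion.v2 SB SH := by
    intro j k e h
    have ex : cubicVecQ (Yc i) = cubicVecQ (Yc j) + (LinearIsometryEquiv.refl ℝ (EuclideanSpace ℝ (Fin 3))) (slotSite k) := by
      rw [e, cubicVecQ_add, slotSite_eq_cubicVecQ]; rfl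
    rw [ex]; exact h (add_slot_mem_pieceOf Yset_window _ _ k (by rw [← ex]; exact mem_Yset i))
  have site1 : ∀ (j : Fin 21) (c₁ : Fin 8) (k : Fin 12), Yc i = Yc j + reflQ c₁ (slotQ k) → pieceOf Yset 0 (cubicVecQ (Yc j)) (frame1 c₁) ⊆ unionCore Yset 0 WordVersion.v2 SB SH →
      cubicVecQ (Yc i) ∈ unionCore Yset 0 WordVersion.v2 SB SH := by
    intro j c₁ k e h
    have ex : cubicVecQ (Yc i) = cubicVecQ (Yc j) + frame1 c₁ (slotSite k) := by
      rw [e, cubicVecQ_add, slotSite_eq_cubicVecQ, frame1_cubicVecQ]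
    rw [ex]; exact h (add_slot_mem_pieceOf Yset_window _ _ k (by rw [← ex]; exact mem_Yset i))
  rcases tab_cover i hi with (rfl | ⟨k, e⟩) | (rfl | ⟨k, e⟩) | (rfl | ⟨k, e⟩) | (rfl | ⟨k, e⟩) | (rfl | ⟨k, e⟩)
  · exact base 2 _ mover2.2
  · exact site0 2 k e mover2.2
  · exact base 3 _ mover3.2
  · exact site0 3 k e mover3.2
  · exact base 7 _ mover7.2
  · exact site1 7 6 k e mover7.2
  · exact base 9 _ mover9.2
  · exact site1 9 7 k e mover9.2
  · exact base 10 _ mover10.2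
  · exact site1 10 7 k e mover10.2

open scoped Classical in
/-- **The generators of the union core lie in `K`**: a piece containing a junk ball carries no (A)-pair (module obstruction ⇒ at most one `K`-site; single-contact
junk ⇒ no unit triangle among the sites ⇒ the piece is its site set and has no triangle; but a pair needs one). -/
theorem generators_subset_Kset {x c : EuclideanSpace ℝ (Fin 3)} {S : EuclideanSpace ℝ (Fin 3) ≃ₗᵢ[ℝ] EuclideanSpace ℝ (Fin 3)} (hxP : x ∈ pieceOf Yset 0 c S)
    {b q : EuclideanSpace ℝ (Fin 3)} (hpair : IsEndPairA (pieceOf Yset 0 c S) WordVersion.v2 SB SH b q) : x ∈ Kset := by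
  set W := Yset.filter fun y => dist (0 : EuclideanSpace ℝ (Fin 3)) y ≤ 3 with hW
  set T := W.filter fun y => S.symm (y - c) ∈ coaxialModule 1 (Real.sqrt (2 / 3)) with hT
  have hP : pieceOf Yset 0 c S = capClosure W T := rfl
  have hTW : T ⊆ W := Finset.filter_subset _ _
  have hWY : W ⊆ Yset := Finset.filter_subset _ _
  have hKcl : ∀ y ∈ W, CapsTriangleIn Kset y → y ∈ Kset := fun y hy h => mem_Kset_of_capsTriangleIn (hWY hy) h
  by_cases hTK : T ⊆ Kset
  · exact capClosure_subset_of_closed hTK hKcl (hP ▸ hxP)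
  · exfalso
    obtain ⟨j₀, hj₀T, hj₀K⟩ := Finset.not_subset.1 hTK
    have hj₀Y : j₀ ∈ Yset := hWY (hTW hj₀T)
    have hsite : ∀ y ∈ T, S.symm (y - c) ∈ coaxialModule 1 (Real.sqrt (2 / 3)) := fun y hy => (Finset.mem_filter.1 hy).2
    -- two distinct K-sites are impossible
    have hone : ∀ y ∈ T, ∀ y' ∈ T, y ∈ Kset → y' ∈ Kset → y = y' := by
      intro y hy y' hy' hyK hy'K
      by_contra hne
      obtain ⟨N, hN⟩ := inner_sites_twelfth S (hsite j₀ hj₀T) (hsite y hy) (hsite y' hy')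
      exact junk_obstruction hj₀Y hj₀K hyK hy'K hne N hN
    -- hence no unit triangle in T
    have hnotri : ∀ a ∈ T, ∀ a' ∈ T, ∀ a'' ∈ T, ¬ (dist a a' = 1 ∧ dist a a'' = 1 ∧ dist a' a'' = 1) := by
      intro a ha a' ha' a'' ha'' ⟨h1, h2, h3⟩
      have haY := hWY (hTW ha); have ha'Y := hWY (hTW ha'); have ha''Y := hWY (hTW ha'')
      by_cases haK : a ∈ Kset
      · have ha'K : a' ∉ Kset := fun h => by
          have := hone a ha a' ha' haK h; rw [this, dist_self] at h1; exact zero_ne_one h1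
        -- a' junk touches a and a'': both in K and equal
        have ha''K : a'' ∈ Kset := junk_contact_mem_Kset ha'Y ha'K ha''Y h3
        have := hone a ha a'' ha'' haK ha''K
        rw [this, dist_self] at h2; exact zero_ne_one h2
      · have ha'K : a' ∈ Kset := junk_contact_mem_Kset haY haK ha'Y h1
        have ha''K : a'' ∈ Kset := junk_contact_mem_Kset haY haK ha''Y h2
        have := hone a' ha' a'' ha'' ha'K ha''K
        rw [this, dist_self] at h3; exact zero_ne_one h3
    have hPT : pieceOf Yset 0 c S = T := by rw [hP, capClosure_eq_of_no_triangle hnotri]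
    obtain ⟨a, ha, a', ha', a'', ha'', h1, h2, h3⟩ := exists_triangle_of_isEndPairA hpair
    rw [hPT] at ha ha' ha''
    exact hnotri a ha a' ha' a'' ha'' ⟨h1, h2, h3⟩

open scoped Classical in
/-- **`unionCore⋆ ⊆ K`.** -/
theorem unionCoreStar_subset_Kset : unionCoreStar Yset 0 WordVersion.v2 SB SH ⊆ Kset := by
  have hWY : (Yset.filter fun y => dist (0 : EuclideanSpace ℝ (Fin 3)) y ≤ 3) ⊆ Yset := Finset.filter_subset _ _
  have hKcl : ∀ y ∈ (Yset.filter fun y => dist (0 : EuclideanSpace ℝ (Fin 3)) y ≤ 3), CapsTriangleIn Kset y → y ∈ Kset :=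
    fun y hy h => mem_Kset_of_capsTriangleIn (hWY hy) h
  have hScl : ∀ y ∈ (Yset.filter fun y => dist (0 : EuclideanSpace ℝ (Fin 3)) y ≤ 3), StarSiteIn Kset y → y ∈ Kset :=
    fun y hy h => mem_Kset_of_starSiteIn (hWY hy) h
  refine starClosure_subset_of_closed (capClosure_subset_of_closed ?_ hKcl) hKcl hScl
  intro x hx
  obtain ⟨-, c, S, hxP, b, q, -, -, hpair⟩ := Finset.mem_filter.1 hx
  exact generators_subset_Kset hxP hpair

open scoped Classical in
/-- **`unionCore⋆ = K`.** -/
theorem unionCoreStar_eq_Kset : unionCoreStar Yset 0 WordVersion.v2 SB SH = Kset :=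
  Subset.antisymm unionCoreStar_subset_Kset (Kset_subset_unionCore.trans unionCore_subset_unionCoreStar)

/-! ### The value at the payer: five movers over a pool of one -/

open scoped Classical in
/-- **At least five (A)-end movers into the payer in its star-closed union core.** -/
theorem five_le_endMultA : 5 ≤ endMultA (unionCoreStar Yset 0 WordVersion.v2 SB SH) WordVersion.v2 SB SH 0 := by
  have hzb : dist (0 : EuclideanSpace ℝ (Fin 3)) 0 ≤ 1 := by simp
  set M : Finset (Fin 21) := {2, 3, 7, 9, 10} with hM
  have hpairs : ∀ i ∈ M, IsEndPairA Yset WordVersion.v2 SB SH 0 (cubicVecQ (Yc i)) := by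
    intro i hi
    simp only [hM, Finset.mem_insert, Finset.mem_singleton] at hi
    rcases hi with rfl | rfl | rfl | rfl | rfl
    exacts [mover2.1, mover3.1, mover7.1, mover9.1, mover10.1]
  unfold endMultA
  calc 5 = M.card := by rw [hM]; decide
    _ ≤ _ := Finset.card_le_card_of_injOn (fun i => cubicVecQ (Yc i)) (fun i hi => ?_) (fun i _ j _ h => Yc_injective (cubicVecQ_injective h))
  rw [Finset.mem_coe, Finset.mem_filter]
  have hp := isEndPairA_unionCoreStar (z := (0 : EuclideanSpace ℝ (Fin 3))) Yset_separated SB_RT SH_RT hzb (hpairs i hi)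
  exact ⟨hp.1, hp⟩

/-- Junk index touching the `K`-ball `i` (for the payer and its seven contacts; `0` elsewhere, unused). -/
def jk : Fin 21 → Fin 21 := ![13, 0, 14, 15, 16, 0, 0, 17, 0, 18, 19, 20, 0, 0, 0, 0, 0, 0, 0, 0, 0]

open scoped Classical in
/-- The payer and its seven `K`-contacts: their junk balls, their `K`-degrees, and (for the movers) the antipodal predecessor `2y` (table). -/
theorem tab_near : ∀ i : Fin 21, i.val < 13 → qdot (Yc i - 0) (Yc i - 0) ≤ 2 →
    13 ≤ (jk i).val ∧ qdot (Yc (jk i) - Yc i) (Yc (jk i) - Yc i) = 2 ∧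
    (i = 0 ∨ ((Finset.univ.filter fun j : Fin 21 => j.val < 13).filter fun j => qdot (Yc i - Yc j) (Yc i - Yc j) = 2).card ≤ 4 ∨
      (((Finset.univ.filter fun j : Fin 21 => j.val < 13).filter fun j => qdot (Yc i - Yc j) (Yc i - Yc j) = 2).card ≤ 5 ∧ qdot (Yc i - 0) (Yc i - 0) = 2 ∧
        ∃ p : Fin 21, p.val < 13 ∧ Yc p = Yc i + Yc i ∧ qdot (Yc i - Yc p) (Yc i - Yc p) = 2)) := by
  decide +kernel

open scoped Classical in
/-- The payer has exactly seven `K`-contacts (table). -/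
theorem tab_degK_zero : ((Finset.univ.filter fun j : Fin 21 => j.val < 13).filter fun j => qdot (Yc 0 - Yc j) (Yc 0 - Yc j) = 2).card = 7 := by
  decide +kernel

open scoped Classical in
/-- **Every `K`-ball within `1` of the payer is UNSEALED** (its junk ball touches it). -/
theorem not_isSealed_of_near {i : Fin 21} (hi : i.val < 13) (hnear : qdot (Yc i - 0) (Yc i - 0) ≤ 2) : ¬ IsSealed Yset Kset (cubicVecQ (Yc i)) := by
  obtain ⟨hj, hd, -⟩ := tab_near i hi hnear
  intro h
  refine h _ (mem_Yset (jk i)) (fun hK => ?_) ?_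
  · have := idx_lt_of_mem_Kset hK; omega
  · rw [dist_comm]; exact (dist_Yc_eq_one_iff _ _).2 hd

open scoped Classical in
/-- **The certified gain of every `K`-contact of the payer is `0`** (`≤ 4` core contacts, or `5` with the antipodal pair `{0, 2y}`). -/
theorem sealedGain_eq_zero_of_contact {i : Fin 21} (hi : i.val < 13) (hi0 : i ≠ 0) (hnear : qdot (Yc i - 0) (Yc i - 0) ≤ 2) :
    sealedGain Yset Kset (cubicVecQ (Yc i)) = 0 := by
  unfold sealedGain
  rw [if_neg (not_isSealed_of_near hi hnear)]
  obtain ⟨-, -, h⟩ := tab_near i hi hnear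
  rcases h with h | h4 | ⟨h5, hq0, p, hp, hpp, hqp⟩
  · exact absurd h hi0
  · have h4' : (Kset.filter fun q => dist (cubicVecQ (Yc i)) q = 1).card ≤ 4 := by rw [card_contacts_Kset]; exact h4
    exact capGain_capTable₃_eq_zero (h4'.trans (by norm_num)) (starCap_eq_twelve_of_card_le_four h4')
  · have h5' : (Kset.filter fun q => dist (cubicVecQ (Yc i)) q = 1).card ≤ 5 := by rw [card_contacts_Kset]; exact h5
    have hd₁ : dist (cubicVecQ (Yc i)) 0 = 1 := by rw [← cubicVecQ_zero]; exact (dist_cubicVecQ_eq_one_iff _ _).2 hq0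
    have hd₂ : dist (cubicVecQ (Yc i)) (cubicVecQ (Yc p)) = 1 := (dist_Yc_eq_one_iff i p).2 hqp
    have hanti : (0 : EuclideanSpace ℝ (Fin 3)) - cubicVecQ (Yc i) = -(cubicVecQ (Yc p) - cubicVecQ (Yc i)) := by
      rw [hpp, cubicVecQ_add]; abel
    exact capGain_capTable₃_eq_zero h5' (starCap_eq_twelve_of_antipodal h5' zero_mem_Kset (mem_Kset hp) hd₁ hd₂ hanti)

open scoped Classical in
/-- **The payer's own certified gain is at most `1`** (it is unsealed and has exactly seven core contacts). -/
theorem sealedGain_zero_le_one : sealedGain Yset Kset 0 ≤ 1 := by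
  have h := not_isSealed_of_near (i := 0) (by decide) (by decide +kernel)
  rw [cubicVecQ_Yc_zero] at h
  unfold sealedGain
  rw [if_neg h]
  refine capGain_capTable₃_le_one ?_
  rw [← cubicVecQ_Yc_zero, card_contacts_Kset]
  exact tab_degK_zero

open scoped Classical in
/-- **The payer's pool is `1`** (as an upper bound): its own gain is `≤ 1` and every other core ball within `1` has gain `0`. -/
theorem sealedPool_zero_le_one : sealedPool Yset Kset 0 0 ≤ 1 := by
  unfold sealedPool
  rw [if_pos zero_mem_Kset, max_eq_left sealedGain_zero_le_one, Finset.sum_eq_zero]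
  · norm_num
  intro y hy
  obtain ⟨hy, hd⟩ := Finset.mem_filter.1 hy
  obtain ⟨hy0, hyK⟩ := Finset.mem_erase.1 hy
  obtain ⟨i, hi, rfl⟩ := mem_Kset_iff.1 hyK
  have hi0 : i ≠ 0 := fun h => hy0 (by rw [h, cubicVecQ_Yc_zero])
  have hnear : qdot (Yc i - 0) (Yc i - 0) ≤ 2 := by
    rw [dist_comm, ← cubicVecQ_zero] at hd
    have hd' : dist (cubicVecQ (Yc i)) (cubicVecQ 0) ≤ ((1 : ℚ) : ℝ) := by push_cast; exact hd
    have := (dist_cubicVecQ_le_iff (Yc i) 0 (by norm_num : (0 : ℚ) ≤ 1)).1 hd'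
    linarith
  exact sealedGain_eq_zero_of_contact hi hi0 hnear

/-! ### The refutation -/

open scoped Classical in
/-- **`TailResidue.UnionCoreSealedCapWin₃ (2·√6)` IS FALSE** — the UNFLOORED PAYER TERM: on the 21-ball window `Yset` the payer `0` (eight contacts) is the target of
five narrow movers of its own star-closed union core `= K`, its sealed pool is `1`, so `sealedSummand₃ ≥ 5 > 2√6`. -/
theorem not_unionCoreSealedCapWin₃ : ¬ UnionCoreSealedCapWin₃ (2 * Real.sqrt 6) := by
  intro h
  have hdeg : (Yset.filter fun q => dist (0 : EuclideanSpace ℝ (Fin 3)) q = 1).card ≤ 11 := by rw [card_contacts_zero]; norm_num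
  have hle : sealedSummand₃ WordVersion.v2 SB SH Yset (unionCoreStar Yset 0 WordVersion.v2 SB SH) 0 ≤ 2 * Real.sqrt 6 :=
    h Yset Yset_window Yset_separated zero_mem_Yset hdeg
  have h5 := five_le_endMultA
  rw [unionCoreStar_eq_Kset] at hle h5
  unfold sealedSummand₃ at hle
  have hmem : (0 : EuclideanSpace ℝ (Fin 3)) ∈ Kset.filter (fun b => dist (0 : EuclideanSpace ℝ (Fin 3)) b ≤ 1 ∧ 0 < endMultA Kset WordVersion.v2 SB SH b) :=
    Finset.mem_filter.2 ⟨zero_mem_Kset, by simp, by omega⟩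
  have hpos := sealedPool₃_pos Yset Kset 0 0
  have hterm : (5 : ℝ) ≤ (endMultA Kset WordVersion.v2 SB SH 0 : ℝ) / sealedPool₃ Yset Kset 0 0 := by
    rw [le_div_iff₀ hpos]
    have hp1 : sealedPool₃ Yset Kset 0 0 ≤ 1 := by unfold sealedPool₃; rw [if_pos rfl]; exact sealedPool_zero_le_one
    have h5' : (5 : ℝ) ≤ (endMultA Kset WordVersion.v2 SB SH 0 : ℝ) := by exact_mod_cast h5
    nlinarith
  have hsum : (endMultA Kset WordVersion.v2 SB SH 0 : ℝ) / sealedPool₃ Yset Kset 0 0 ≤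
      ∑ b ∈ Kset.filter (fun b => dist (0 : EuclideanSpace ℝ (Fin 3)) b ≤ 1 ∧ 0 < endMultA Kset WordVersion.v2 SB SH b),
        (endMultA Kset WordVersion.v2 SB SH b : ℝ) / sealedPool₃ Yset Kset 0 b :=
    Finset.single_le_sum (f := fun b => (endMultA Kset WordVersion.v2 SB SH b : ℝ) / sealedPool₃ Yset Kset 0 b)
      (fun b _ => div_nonneg (Nat.cast_nonneg _) (sealedPool₃_pos Yset Kset 0 b).le) hmem
  have h56 : (5 : ℝ) ≤ 2 * Real.sqrt 6 := hterm.trans (hsum.trans hle)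
  nlinarith [Real.sq_sqrt (show (0 : ℝ) ≤ 6 by norm_num), Real.sqrt_nonneg 6, mul_self_le_mul_self (by norm_num : (0 : ℝ) ≤ 5) h56]

/-- **The registered stub `Cruxes.CoaxialWallLaw.Certificates.stub_unionCoreSealedCapWin3 : TailResidue.UnionCoreSealedCapWin₃ (2 * Real.sqrt 6)` (lane F v8.3) is
false** — verbatim its type. -/
theorem not_stub_unionCoreSealedCapWin3 : ¬ TailResidue.UnionCoreSealedCapWin₃ (2 * Real.sqrt 6) := not_unionCoreSealedCapWin₃

/-! ### Corollaries: every floor-1-at-the-payer form of the union-core certificate is false at `2√6` -/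

/-- The floor-3 STAR certificate `UnionCoreStarCapWin₃ (2√6)` ('…SeamThreePayer', the «repair #1» input) is false as well: it implies the sealed one. -/
theorem not_unionCoreStarCapWin₃ : ¬ UnionCoreStarCapWin₃ (2 * Real.sqrt 6) := fun h => not_unionCoreSealedCapWin₃ (unionCoreSealedCapWin₃_of_win₃ h)

/-- The windowed floor-1 STAR certificate `UnionCoreStarCapWin (2√6)` ('…SeamPayerFloorStd') is false. -/
theorem not_unionCoreStarCapWin : ¬ UnionCoreStarCapWin (2 * Real.sqrt 6) := fun h => not_unionCoreStarCapWin₃ (unionCoreStarCapWin₃_of_win h)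

/-- The standard-frame STAR certificate `UnionCoreStarCapStd (2√6)` ('…SeamPayerFloorStd') is false. -/
theorem not_unionCoreStarCapStd : ¬ UnionCoreStarCapStd (2 * Real.sqrt 6) := fun h => not_unionCoreStarCapWin (unionCoreStarCapWin_of_std h)

/-- The every-frame STAR certificate `UnionCoreStarCap (2√6)` ('…SeamPayerFloor') is false. -/
theorem not_unionCoreStarCap : ¬ UnionCoreStarCap (2 * Real.sqrt 6) := fun h => not_unionCoreStarCapStd (unionCoreStarCapStd_of_cap h)

end ZTerm

end Summit.Ventures.Crystal3D.Theorems

end
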